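import Summits.QuantumFields.BalabanUV.T4Continuum.Support.NE7StraightPartOperator
import Summits.QuantumFields.BalabanUV.T4Continuum.Support.NE7FlatSliceSourceDuality
import HarnessLib

/-!
# NE7SliceLagrangeMultiplier — THE SLICE EQUATION OF (KL-B) IN LAGRANGE FORM: a real linear functional on direction fields that vanishes on the skew periodic
# STRAIGHT-TANGENT fields `{Y skew, (N·L^{j+1})-periodic, QbarIter L (j+1) W Y = 0}` IS `Y ↦ ⟨μ, QbarIter L (j+1) W Y⟩_{periodBox N}` for a skew `N`-periodic coarse
# source `μ` (the Lagrange multiplier); hence «`hess_W(X″, ·) = ⟨H, ·⟩` on Bałaban's slice» ⟺ «`hess_W(X″, ·) = ⟨H, ·⟩ + ⟨μ, QbarIter ·⟩` on ALL skew periodic tests» —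
# the hypothesis `S₀ x = h + Qᵀμ` of F166 `NE7ConstrainedGreenBalabanGauge.eq_source_of_gaugeFixed` in the tree's vocabulary (file 120 of the curved (APE), F191)

Cell `pub-balaban`, rung (B)+1 sub-cell t4, lineage `b2b-balaban-t4-ne7-p1` (CRUX PROVER NE7 #1 = OWNER of row NE7), generation 85; memo
`t4/b2b-balaban-t4-ne7-p1-g85/LAGRANGE-CARRIER.md` §1.  Over row NE3's Hilbert-space chart of the torus 1-forms (`NE3HilbertSchmidtTorus`: `Form d n P = ℓ²` of
`(ℤ∕P)^d × Fin d → (M_n(ℂ), hsR)`, `extF`∕`resF`, `inner_resF`), `NE7SkewTorusForms.exists_skewForms` (the skew forms as a submodule), `NE7StraightPartOperator.QbarIter_skew`, `NE7CombLineSumCoercive.resF_smul`,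
row NE3's `QbarIter_add`∕`QbarIter_smul`∕`isPeriodicDir_QbarIter`, lineage #2's `NE7FlatSliceSourceDuality` (`srcPair`, `exists_skewSource_of_l1DualBound`) BY NAME, and Mathlib's
`LinearMap.range_dualMap_eq_dualAnnihilator_ker` (annihilator of the kernel = range of the transpose) + `InnerProductSpace.toDual` (Riesz).
WHY.  After F188 (`NE7ApeCurvedRepRoadBScalarFreeEnd`) the curved (APE) on road (B) rests on ONE letter (KL-B), read in SOURCE form by F173: «`QbarIter X″ = 0`,
`IsLandauB8 X″`, `hess_W(X″, Y) = ⟨H, Y⟩` for the skew periodic STRAIGHT-TANGENT `Y`, `‖H‖_∞ ≤ g` ⟹ `‖curl_W X″‖ ≤ K·g`».  F166 turns such an `X″` into `C_a(W)H` (the curl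
row of Bałaban's constrained propagator, [B9] Thm 3.3 TYPE) from the LAGRANGE form `S₀X″ = H + QbarIterᵀμ` of the equation on the WHOLE space.  THIS file supplies the
multiplier: finite-dimensional duality on the torus chart (no estimate, no smallness beyond the class lines that make `QbarIter` linear).
WHAT ([folklore]; 0 def, 0 sorry).  §1 `exists_inner_repr_of_vanish_on_ker` (abstract: a functional killing `ker Q` is `⟪m, Q·⟫`); §2 **`exists_multiplier_of_sliceFunctional`**
(the carrier theorem: `φ = ⟨μ, QbarIter L (j+1) W ·⟩_{periodBox N}` on the skew `(N·L^{j+1})`-periodic fields, `μ` skew `N`-periodic); §3 **`sliceEq_lagrangeForm`** (the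
source form of (KL-B)'s equation ⟹ its Lagrange form on all skew periodic tests) and **`sliceFunctional_lagrangeForm`** (the functional form `|hess_W(X″,Y)| ≤ g″‖Y‖₁` on the
slice ⟹ a skew periodic source `H`, `‖H‖_∞ ≤ card n·g″`, AND a multiplier `μ` with the Lagrange form).
HONEST FRAMING (page 1): finite-dimensional linear algebra; NO estimate (the multiplier's SIZE is not bounded here — in print it is `(QGQ*)⁻¹QGH`, [B9] (3.49)); nothing of
Bałaban's asserted; (KL-B) at curved `W` NOT proved; (APE) on curved data NOT proved; NOT ONE-STEP, NOT NE7; spine 0∕9; finite T⁴ rung (B)+1 — NOT infinite volume, NOT mass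
gap, NOT `BetaPertH`, NOT Clay.  Continuum YM on T⁴ ⇐ BetaPertH ∧ nine spine estimates (0/9 proved); BetaPertH ⇐ (D1) ∧ (D4) ∧ CAP+tail; G-an2-4 gates asym, D1 and NE2/3/4.
-/

set_option autoImplicit false

open scoped BigOperators InnerProductSpace Matrix Matrix.Norms.L2Operator
open Finset

namespace Summit.QuantumFields.BalabanUV.T4Continuum.NE7SliceLagrangeMultiplier

open Literature.MathematicalPhysics.QuantumFieldTheory.Balaban1983to89
open B7Prop1Explicit B7Prop2Explicit UnitaryModel
open T4AveragingDeficitWall (IsUnitaryCfg IsSkewDir SmallField dirL1)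
open T4AveragingDeficitWallBoundary (periodBox IsPeriodicCfg)
open AveragingDeficitPeriodicCounting (IsPeriodicDir)
open AveragingDeficitMultiLevelPrep (tower LevelSmall)
open AveragingDeficitMultiLevelBridge (tower_eq)
open MinimalActionLevels (perWin)
open NE3HessForm (hess)
open NE3EnergyHessBilin (hessBilin hessBilin_apply)
open NE3TangentCovariantTower (QbarIter)
open NE3CovariantLineSumsTower (QbarIter_add)
open NE3SmoothRightInverseW (QbarIter_smul)
open NE3FramePotBoundW (isPeriodicDir_QbarIter)
open NE3CovariantCalculus (hsR hsR_add_right)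
open NE3HilbertSchmidtTorus
open NE7SkewTorusForms (exists_skewForms isSkewDir_extF_resF)
open NE7CombLineSumCoercive (resF_smul)
open NE7StraightPartOperator (QbarIter_skew)
open NE7FlatSliceSourceDuality (srcPair abs_srcPair_le hsR_smul_right' periodic_eq_boxVec_redN exists_skewSource_of_l1DualBound)

noncomputable section

/-! ## §1 Abstract: a functional that kills `ker Q` is `⟪m, Q ·⟫` -/

/-- **LAGRANGE MULTIPLIERS IN A FINITE-DIMENSIONAL HILBERT SPACE.**  For a real linear map `Q : E → F` into a finite-dimensional real inner product space and a real
linear functional `ψ` on `E` with `ker Q ⊆ ker ψ`, there is `m ∈ F` with `ψ = ⟪m, Q ·⟫` (annihilator of the kernel = range of the transpose, then Riesz in `F`). [folklore] -/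
theorem exists_inner_repr_of_vanish_on_ker {E F : Type*} [AddCommGroup E] [Module ℝ E] [NormedAddCommGroup F] [InnerProductSpace ℝ F] [FiniteDimensional ℝ F]
    (Q : E →ₗ[ℝ] F) (ψ : E →ₗ[ℝ] ℝ) (hψ : ∀ b : E, Q b = 0 → ψ b = 0) :
    ∃ m : F, ∀ b : E, ψ b = ⟪m, Q b⟫_ℝ := by
  haveI : CompleteSpace F := FiniteDimensional.complete ℝ F
  have hmem : ψ ∈ (LinearMap.ker Q).dualAnnihilator :=
    (Submodule.mem_dualAnnihilator ψ).mpr fun b hb => hψ b (LinearMap.mem_ker.mp hb)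
  rw [← LinearMap.range_dualMap_eq_dualAnnihilator_ker] at hmem
  obtain ⟨g, hg⟩ := LinearMap.mem_range.mp hmem
  refine ⟨(InnerProductSpace.toDual ℝ F).symm (LinearMap.toContinuousLinearMap g), fun b => ?_⟩
  rw [InnerProductSpace.toDual_symm_apply, LinearMap.coe_toContinuousLinearMap', ← hg, LinearMap.dualMap_apply]

/-! ## §2 The carrier theorem: the multiplier of a functional vanishing on Bałaban's skew periodic slice -/

variable {d : ℕ} {n : Type*} [Fintype n] [DecidableEq n]

omit [Fintype n] [DecidableEq n] in
/-- A torus 1-form whose restriction vanishes, vanishes on the representatives. [folklore] -/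
theorem apply_boxVec_eq_zero_of_resF_eq_zero (P : ℕ) {Y : Site d → Fin d → (Matrix n n ℂ)} (h : resF (d := d) P Y = 0) (s : Fin d → Fin P) (κ : Fin d) :
    Y (boxVec P s) κ = 0 := by
  have h1 := congrArg (fun f : Form d n P => HSMat.ofHS (f (s, κ))) h
  simp only [resF_apply, HSMat.ofHS_toHS] at h1
  rw [h1, WithLp.ofLp_zero, Pi.zero_apply, HSMat.ofHS_zero]

/-- **THE SOURCE PAIRING AS A LINEAR FUNCTIONAL** in the direction field (for §3). [folklore] -/
theorem exists_srcPair_linear (H : Site d → Fin d → (Matrix n n ℂ)) (B : Finset (Site d)) :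
    ∃ σ : (Site d → Fin d → (Matrix n n ℂ)) →ₗ[ℝ] ℝ, ∀ Y, σ Y = srcPair H Y B := by
  refine ⟨{ toFun := fun Y => srcPair H Y B, map_add' := fun Y Z => ?_, map_smul' := fun t Y => ?_ }, fun Y => rfl⟩
  · simp only [srcPair, Pi.add_apply, hsR_add_right, Finset.sum_add_distrib]
  · simp only [srcPair, Pi.smul_apply, hsR_smul_right', RingHom.id_apply, smul_eq_mul, Finset.mul_sum]

/-- **THE LAGRANGE MULTIPLIER ON THE CARRIER.**  In the multi-level small-field class at a unitary `(N·L^{j+1})`-periodic background `W` (the lines making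
`QbarIter L (j+1) W` real-linear), every real linear functional `φ` on direction fields that VANISHES on the skew `(N·L^{j+1})`-periodic straight-tangent fields
(`QbarIter L (j+1) W Y = 0`) is, on the skew `(N·L^{j+1})`-periodic fields, the pairing `⟨μ, QbarIter L (j+1) W ·⟩_{periodBox N}` with a SKEW `N`-PERIODIC coarse field `μ`.
(Skew forms of the torus chart; `QbarIter` descends to a linear map between them; its kernel there is the slice by `N`-periodicity of the coarse field; §1.) [folklore] -/
theorem exists_multiplier_of_sliceFunctional [Nonempty n] {L N : ℕ} [NeZero N] (hL : 1 ≤ L) (j : ℕ)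
    {W : Site d → Fin d → (Matrix n n ℂ)ˣ} {x : ℝ} (hWu : IsUnitaryCfg W) (hWP : IsPeriodicCfg W ((N * L ^ (j + 1) : ℕ) : ℤ))
    (hx : 0 ≤ x) (hs : LevelSmall d L j x) (hWx : SmallField W x)
    (φ : (Site d → Fin d → (Matrix n n ℂ)) →ₗ[ℝ] ℝ)
    (hφ : ∀ Y : Site d → Fin d → (Matrix n n ℂ), IsSkewDir Y → IsPeriodicDir Y ((N * L ^ (j + 1) : ℕ) : ℤ) → QbarIter L (j + 1) W Y = 0 → φ Y = 0) :
    ∃ μ : Site d → Fin d → (Matrix n n ℂ), IsSkewDir μ ∧ IsPeriodicDir μ (N : ℤ) ∧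
      ∀ Y : Site d → Fin d → (Matrix n n ℂ), IsSkewDir Y → IsPeriodicDir Y ((N * L ^ (j + 1) : ℕ) : ℤ) →
        φ Y = srcPair μ (QbarIter L (j + 1) W Y) (periodBox (d := d) N) := by
  haveI : NeZero (N * L ^ (j + 1)) := ⟨Nat.mul_ne_zero (NeZero.ne N) (pow_ne_zero _ (by omega))⟩
  set P : ℕ := N * L ^ (j + 1) with hPdef
  -- the skew torus 1-forms, fine and coarse
  obtain ⟨Kf, hKf⟩ := exists_skewForms (d := d) (n := n) P
  obtain ⟨Kc, hKc⟩ := exists_skewForms (d := d) (n := n) N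
  -- `QbarIter` on the chart, as a real linear map `Form P → Form N`
  let Q₀ : Form d n P →ₗ[ℝ] Form d n N :=
    { toFun := fun b => resF N (QbarIter L (j + 1) W (extF P b))
      map_add' := fun a b => by
        have h : extF P (a + b) = fun y μ => extF P a y μ + extF P b y μ := rfl
        rw [h, QbarIter_add hL j hWu hx hs hWx, resF_add]
      map_smul' := fun t b => by
        have h : extF P (t • b) = t • extF P b := rfl
        rw [h, QbarIter_smul hL j hWu hx hs hWx, RingHom.id_apply]
        exact resF_smul N t _ }
  have hQ₀ : ∀ b : Form d n P, Q₀ b = resF N (QbarIter L (j + 1) W (extF P b)) := fun b => rfl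
  -- it maps skew forms to skew forms
  have hQ₀mem : ∀ b : Form d n P, b ∈ Kf → Q₀ b ∈ Kc := by
    intro b hb
    rw [hQ₀, hKc]
    exact isSkewDir_extF_resF N (QbarIter_skew hL j hWu hx hs hWx ((hKf b).mp hb))
  let Q : Kf →ₗ[ℝ] Kc := (Q₀.domRestrict Kf).codRestrict Kc fun b => hQ₀mem b b.2
  have hQ : ∀ b : Kf, ((Q b : Kc) : Form d n N) = resF N (QbarIter L (j + 1) W (extF P (b : Form d n P))) := fun b => rfl
  -- the functional on the skew forms
  let X : Form d n P →ₗ[ℝ] (Site d → Fin d → (Matrix n n ℂ)) :=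
    { toFun := extF P, map_add' := fun a b => rfl, map_smul' := fun t b => rfl }
  let ψ : Kf →ₗ[ℝ] ℝ := φ ∘ₗ X ∘ₗ Kf.subtype
  have hψ : ∀ b : Kf, ψ b = φ (extF P (b : Form d n P)) := fun b => rfl
  -- its kernel contains `ker Q`: a coarse field vanishing on the representatives vanishes, by `N`-periodicity
  have hker : ∀ b : Kf, Q b = 0 → ψ b = 0 := by
    intro b hb
    have hb0 : resF N (QbarIter L (j + 1) W (extF P (b : Form d n P))) = 0 := by
      rw [← hQ b, hb, Submodule.coe_zero]
    have htow : ((tower L N (j + 1) : ℕ) : ℤ) = ((P : ℕ) : ℤ) := by rw [tower_eq]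
    have hWP' : IsPeriodicCfg W ((tower L N (j + 1) : ℕ) : ℤ) := by rw [htow]; exact hWP
    have hbP : IsPeriodicDir (extF P (b : Form d n P)) ((tower L N (j + 1) : ℕ) : ℤ) := by rw [htow]; exact isPeriodicDir_extF _ _
    have hQP : IsPeriodicDir (QbarIter L (j + 1) W (extF P (b : Form d n P))) (N : ℤ) := isPeriodicDir_QbarIter L N (j + 1) hWP' hbP
    have hzero : QbarIter L (j + 1) W (extF P (b : Form d n P)) = 0 := by
      funext y κ
      rw [periodic_eq_boxVec_redN hQP y κ, apply_boxVec_eq_zero_of_resF_eq_zero N hb0]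
      rfl
    rw [hψ]
    exact hφ _ ((hKf _).mp b.2) (isPeriodicDir_extF _ _) hzero
  -- §1 on the skew forms
  obtain ⟨m, hm⟩ := exists_inner_repr_of_vanish_on_ker Q ψ hker
  refine ⟨extF N (m : Form d n N), (hKc _).mp m.2, isPeriodicDir_extF _ _, fun Y hYs hYP => ?_⟩
  have hbmem : resF P Y ∈ Kf := (hKf _).mpr (isSkewDir_extF_resF P hYs)
  have h1 : φ Y = ψ ⟨resF P Y, hbmem⟩ := by rw [hψ, Submodule.coe_mk, extF_resF P hYP]
  rw [h1, hm, Submodule.coe_inner, hQ, Submodule.coe_mk, extF_resF P hYP]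
  conv_lhs => rw [← resF_extF N (m : Form d n N)]
  rw [inner_resF]
  rfl

/-! ## §3 The slice equation of (KL-B): source form ⟹ Lagrange form; functional form ⟹ source + multiplier -/

/-- **THE SOURCE EQUATION ON BAŁABAN's SLICE IN LAGRANGE FORM.**  If `hess_W(X″, Y) = ⟨H, Y⟩_{periodBox (N·L^{j+1})}` for every skew `(N·L^{j+1})`-periodic
straight-tangent `Y` (`QbarIter L (j+1) W Y = 0`), then for a skew `N`-periodic multiplier `μ`:
`hess_W(X″, Y) = ⟨H, Y⟩ + ⟨μ, QbarIter L (j+1) W Y⟩_{periodBox N}` for EVERY skew `(N·L^{j+1})`-periodic `Y` — the shape `S₀x = h + Qᵀμ` of F166. [folklore] -/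
theorem sliceEq_lagrangeForm [Nonempty n] {L N : ℕ} [NeZero N] (hL : 1 ≤ L) (j : ℕ)
    {W : Site d → Fin d → (Matrix n n ℂ)ˣ} {x : ℝ} (hWu : IsUnitaryCfg W) (hWP : IsPeriodicCfg W ((N * L ^ (j + 1) : ℕ) : ℤ))
    (hx : 0 ≤ x) (hs : LevelSmall d L j x) (hWx : SmallField W x)
    {X'' H : Site d → Fin d → (Matrix n n ℂ)}
    (heq : ∀ Y : Site d → Fin d → (Matrix n n ℂ), IsSkewDir Y → IsPeriodicDir Y ((N * L ^ (j + 1) : ℕ) : ℤ) → QbarIter L (j + 1) W Y = 0 →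
      hess W X'' Y (perWin d (N * L ^ (j + 1))) = srcPair H Y (periodBox (d := d) (N * L ^ (j + 1)))) :
    ∃ μ : Site d → Fin d → (Matrix n n ℂ), IsSkewDir μ ∧ IsPeriodicDir μ (N : ℤ) ∧
      ∀ Y : Site d → Fin d → (Matrix n n ℂ), IsSkewDir Y → IsPeriodicDir Y ((N * L ^ (j + 1) : ℕ) : ℤ) →
        hess W X'' Y (perWin d (N * L ^ (j + 1)))
          = srcPair H Y (periodBox (d := d) (N * L ^ (j + 1))) + srcPair μ (QbarIter L (j + 1) W Y) (periodBox (d := d) N) := by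
  obtain ⟨σ, hσ⟩ := exists_srcPair_linear (d := d) H (periodBox (d := d) (N * L ^ (j + 1)))
  obtain ⟨μ, hμs, hμP, hμ⟩ := exists_multiplier_of_sliceFunctional hL j hWu hWP hx hs hWx
    (hessBilin W (perWin d (N * L ^ (j + 1))) X'' - σ)
    (fun Y hYs hYP hYQ => by rw [LinearMap.sub_apply, hessBilin_apply, hσ, heq Y hYs hYP hYQ, sub_self])
  refine ⟨μ, hμs, hμP, fun Y hYs hYP => ?_⟩
  have h := hμ Y hYs hYP
  rw [LinearMap.sub_apply, hessBilin_apply, hσ] at h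
  linarith

/-- **THE FUNCTIONAL FORM OF (KL-B)'s HYPOTHESIS IN LAGRANGE FORM.**  If `|hess_W(X″, Y)| ≤ g″·‖Y‖_{ℓ¹(periodBox)}` on the skew `(N·L^{j+1})`-periodic straight-tangent
tests, then there are a skew `(N·L^{j+1})`-periodic SOURCE `H` with `‖H y κ‖ ≤ card n·g″` (lineage #2's `ℓ¹`–`ℓ^∞` duality on the slice) and a skew `N`-periodic MULTIPLIER `μ`
such that `hess_W(X″, Y) = ⟨H, Y⟩ + ⟨μ, QbarIter L (j+1) W Y⟩_{periodBox N}` for every skew `(N·L^{j+1})`-periodic `Y`. [folklore] -/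
theorem sliceFunctional_lagrangeForm [Nonempty n] {L N : ℕ} [NeZero N] (hL : 1 ≤ L) (j : ℕ)
    {W : Site d → Fin d → (Matrix n n ℂ)ˣ} {x : ℝ} (hWu : IsUnitaryCfg W) (hWP : IsPeriodicCfg W ((N * L ^ (j + 1) : ℕ) : ℤ))
    (hx : 0 ≤ x) (hs : LevelSmall d L j x) (hWx : SmallField W x)
    {X'' : Site d → Fin d → (Matrix n n ℂ)} {g'' : ℝ} (hg : 0 ≤ g'')
    (hfun : ∀ Y : Site d → Fin d → (Matrix n n ℂ), IsSkewDir Y → IsPeriodicDir Y ((N * L ^ (j + 1) : ℕ) : ℤ) → QbarIter L (j + 1) W Y = 0 →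
      |hess W X'' Y (perWin d (N * L ^ (j + 1)))| ≤ g'' * dirL1 Y (periodBox (d := d) (N * L ^ (j + 1)))) :
    ∃ H μ : Site d → Fin d → (Matrix n n ℂ), IsSkewDir H ∧ IsPeriodicDir H ((N * L ^ (j + 1) : ℕ) : ℤ) ∧ (∀ (y : Site d) (κ : Fin d), ‖H y κ‖ ≤ Fintype.card n * g'') ∧
      IsSkewDir μ ∧ IsPeriodicDir μ (N : ℤ) ∧
      ∀ Y : Site d → Fin d → (Matrix n n ℂ), IsSkewDir Y → IsPeriodicDir Y ((N * L ^ (j + 1) : ℕ) : ℤ) →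
        hess W X'' Y (perWin d (N * L ^ (j + 1)))
          = srcPair H Y (periodBox (d := d) (N * L ^ (j + 1))) + srcPair μ (QbarIter L (j + 1) W Y) (periodBox (d := d) N) := by
  haveI : NeZero (N * L ^ (j + 1)) := ⟨Nat.mul_ne_zero (NeZero.ne N) (pow_ne_zero _ (by omega))⟩
  -- the straight-tangent skew periodic fields as a real subspace (as in F173)
  let S : Submodule ℝ (Site d → Fin d → (Matrix n n ℂ)) :=
    { carrier := {Y | IsSkewDir Y ∧ IsPeriodicDir Y ((N * L ^ (j + 1) : ℕ) : ℤ) ∧ QbarIter L (j + 1) W Y = 0}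
      add_mem' := by
        rintro Y Z ⟨hYs, hYP, hYT⟩ ⟨hZs, hZP, hZT⟩
        refine ⟨fun y κ => (skewAdjoint (Matrix n n ℂ)).add_mem (hYs y κ) (hZs y κ), fun y κ μ => ?_, ?_⟩
        · show Y (y + ((N * L ^ (j + 1) : ℕ) : ℤ) • e κ) μ + Z (y + ((N * L ^ (j + 1) : ℕ) : ℤ) • e κ) μ = Y y μ + Z y μ
          rw [hYP, hZP]
        · have h := QbarIter_add hL j hWu hx hs hWx Y Z
          have hYZ : (fun y μ => Y y μ + Z y μ) = Y + Z := rfl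
          rw [hYZ] at h
          rw [h]
          funext z κ
          rw [hYT, hZT]
          simp only [Pi.zero_apply, add_zero]
      zero_mem' := by
        refine ⟨fun y κ => (skewAdjoint (Matrix n n ℂ)).zero_mem, fun y κ μ => rfl, ?_⟩
        have h := QbarIter_smul hL j hWu hx hs hWx 0 (0 : Site d → Fin d → (Matrix n n ℂ))
        rwa [zero_smul, zero_smul] at h
      smul_mem' := by
        rintro c Y ⟨hYs, hYP, hYT⟩
        refine ⟨fun y κ => skewAdjoint.smul_mem c (hYs y κ), fun y κ μ => ?_, ?_⟩
        · show c • Y (y + ((N * L ^ (j + 1) : ℕ) : ℤ) • e κ) μ = c • Y y μ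
          rw [hYP]
        · rw [QbarIter_smul hL j hWu hx hs hWx c Y, hYT, smul_zero] }
  obtain ⟨H, hHs, hHP, hHb, hrep⟩ := exists_skewSource_of_l1DualBound (N * L ^ (j + 1)) S (fun Y hY => hY.1) (fun Y hY => hY.2.1)
    (hessBilin W (perWin d (N * L ^ (j + 1))) X'') hg (fun Y hY => by rw [hessBilin_apply]; exact hfun Y hY.1 hY.2.1 hY.2.2)
  obtain ⟨μ, hμs, hμP, hμ⟩ := sliceEq_lagrangeForm hL j hWu hWP hx hs hWx (X'' := X'') (H := H)
    (fun Y hYs hYP hYQ => by rw [← hessBilin_apply]; exact hrep Y ⟨hYs, hYP, hYQ⟩)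
  exact ⟨H, μ, hHs, hHP, hHb, hμs, hμP, hμ⟩

end

end Summit.QuantumFields.BalabanUV.T4Continuum.NE7SliceLagrangeMultiplier
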